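import Summits.QuantumFields.YangMills.Theorems.BalabanUVNodesN15KingModelSlicesGradHolderOnCarrier
import Literature.MathematicalPhysics.QuantumFieldTheory.King1986.SlicePropagatorStatementsAt
import HarnessLib

/-!
# BalabanUVNodes ∕ N15 — THE KING-MODEL RUNG, CURVED EDITION (PART Ρ-e): KING 1986 PROPOSITION 3.7 (3.63)–(3.65) **AT `A = 0`, BY NAME** —
# `SlicePropagator.Prop37KingOrder (kingSliceKernels …)`: King's genuine slices `G^η_{(j)}`, `0 ≤ j ≤ k − 1`, of the `k`-level `A = 0` propagator on ONE
# carrier inhabit the lit-balaban schema in King's quantifier order («0 < α < 1» first, then `C, δ₀`), uniformly in the level, the volume and the mass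
# (Track A, DAG node N15 = NE2; FAN-OUT v1.1 §N15 s3 «KING-MODEL RUNG … + the one-line statement of what the curved case adds»)

HONEST FRAMING.  Count-neutral (cell `pub-ymgap`, seat `pub-ymgap-dag-n15-e` g17; `--supports stmt-QuantumFields-27366 --as helper` = K3⁸
`SpineGivenEndpointR13SepCoPHV`).  TEMPLATE LITERATURE, `A = 0`: C. King's scalar U(1)-Higgs MODEL on finite tori ([King1986] (2.17) p. 653, (2.20) p. 654,
Prop. 3.7 (3.63)–(3.65) p. 663 — PRINTED and proved there from Theorem 3.3 and scaling; here DECIDED for the tree's objects at `A = 0`, `Ω = T_η`), NOT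
Bałaban's covariant objects; NE2⁺ is NOT PRINTED for those and not proved; NOT a node discharge; nothing continuum ∕ ℝ⁴ ∕ OS ∕ mass-gap ∕ Clay.
0 `sorry`, FOUR plumbing `def`s (the index of slice `j` on the carrier, the unit volume of the finest slice, the level-`k` slice kernels, ★ the `SliceKernels` DATUM) — definition lane; standard axioms.

THE DATUM `kingSliceKernels L k e_M M a m²` (`SliceKernels (d+1)`): sites `S := Tor (fine (L^k) M)` = King's `T_η` (cube `M_ν = 2L^{e_M}`, `η = L^{−k}`); NO bonds
(`B := PEmpty` — (3.64)'s `G_(j)(Γ, b)` is the VECTOR-field slice contracted along contours, absent in the scalar model: the clause is EMPTY BY TYPE, not a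
zero kernel); `dist x y := |x − y|_{T_η}∕L^k` (continuum units); `L`, `k`; `G j` := King's slice in level-`k` units — for `1 ≤ j < k`:
`(L^jη)^{2−D}·𝒢_j` with `𝒢_j` part K's `ksSlice = G^ε_{j+1} − G^ε_j` at the (2.20)-consistent mass `m²(L^jη)²`, read on `T_η` through part Ρ-a's `torCongr`;
for `j = 0`: `η^{2−D}·L²·(fineOp L M′ a_1 L² (L²m²η²))⁻¹ = η^{2−D}C^{(0),η}` (part Ρ-c); `0` for `j ≥ k`; `dG j μ := L^k·(G j (· + e_μ) − G j)` (`∂^η_μ`);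
`Gc := PEmpty.elim`.  HONEST SCOPE (the dictionary): King's normalisation `(L^jη)^{2−D}` and the (2.20) mass scaling are APPLIED as the definition of the
level-`k` kernel of slice `j` (part K proves the one-step identity `ksSlice_eq_king`; the `k − j`-fold (2.20) transport and the telescoped sum (2.17) on `T_η`
are NOT re-proved here) — these members ARE King's `G^η_{(j)}(T_η, 0)` under that dictionary, exactly as part F∕K's headers state.
THIS FILE: the datum (§1), its reading lemmas (§2: `kingSliceKernels_slice∕_dist∕_G∕_dG`, `kingSliceG_of_pos∕_zero`), exponent bookkeeping (§3) and the
weight identity `sliceWeight_eq` (§4).  The clauses and the theorem ★★★ `prop37KingOrder_king_zeroField : Prop37KingOrder (kingSliceKernels …)` are the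
successor files `…SlicesDatumSup` ((3.63)), `…SlicesDatumHolder` ((3.65)), `…Prop37AtZeroField` (assembly) — letters: Ρ-a `kingSliceG_abs_le`∕`kingSliceDG_abs_le`,
Ρ-c `kingSliceZero_abs_le`∕`_step_le`, Ρ-b `kingSliceG_holder_le` + Ρ-c `kingSliceZero_holder_le` ((3.65)₁, α-uniform), Ρ-d `kingSliceDG_holder_le_at` +
`kingSliceZero_dholder_le_at` ((3.65)₂ at α).
WHAT THE CURVED CASE ADDS (one line): Prop. 3.7 for `G_(j)(Ω, A)`, regular `A ≠ 0` (Def. 3.2), `Ω ⊊ T_η`, and the contour clause (3.64) — [King1986] §4∕[Ba 4].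
Locators: [King1986] (2.13)–(2.17) p.653, (2.20) p.654, (3.62) p.663, Prop. 3.7 (3.63)–(3.65) p.663, (4.42) p.675; [Balaban1983RegularityDecay] (1.6), Thms (1.9)–(1.10) p.573.
-/

noncomputable section

namespace Summit.QuantumFields.YangMills.BalabanUVNodes.N15KingModelRung.Curved

open Real Finset Matrix
open Literature.MathematicalPhysics.QuantumFieldTheory.Balaban1983to89.B5Prop11Plancherel (Tor fine unitVec)
open Literature.MathematicalPhysics.QuantumFieldTheory.King1986 (aK aK_pos aK_le)
open Literature.MathematicalPhysics.QuantumFieldTheory.King1986.Torus (fineOp blockOf tdistT tdistT_nonneg tdistT_symm torCongr torCongr_add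
  torCongr_unitVec tdistT_torCongr)
open Literature.MathematicalPhysics.QuantumFieldTheory.King1986.SlicePropagator (SliceKernels Prop37PrintedAt Prop37KingOrder holderDeriv)

variable {d : ℕ} (L : ℕ) [NeZero L]

/-! ## §1 The datum -/

omit [NeZero L] in
/-- The index of slice `1 ≤ j` of a `k`-level run over the cube `2L^{e_M}`, ON THE CARRIER (`e := k + e_M − j − 1`, one extra step, physical volume
exponent `0`, size letter `1`). [cite: King1986, (2.17) p.653] -/
def kingSliceIdx (k eM j : ℕ) (hj : 1 ≤ j) : KSliceIdx d := ⟨k + eM - j - 1, j, hj, 1, le_rfl, 0, Nat.zero_le _, 1, le_rfl⟩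

omit [NeZero L] in
/-- Its period identity with the level-`k` fine torus (`j < k`). [cite: King1986, (2.20) p.654] -/
theorem kingSliceIdx_carrier {k eM : ℕ} (M : Fin (d + 1) → ℕ) (hM : ∀ μ, M μ = 2 * L ^ eM) {j : ℕ} (hj : 1 ≤ j) (hjk : j < k) :
    ∀ μ, fine (L ^ k) M μ = fine (L ^ (kingSliceIdx (d := d) k eM j hj).j) (ksU L (kingSliceIdx k eM j hj)) μ :=
  sliceCarrier_eq L (kingSliceIdx k eM j hj) M hM (by simp only [kingSliceIdx]; omega)

omit [NeZero L] in
/-- The unit volume of the finest slice: `M′_ν = 2L^{e_M + k − 1}` (`T_η = Tor (fine L M′)`). [cite: King1986, (2.16)–(2.17) p.653] -/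
def kingZeroVol (k eM : ℕ) : Fin (d + 1) → ℕ := fun _ => 2 * L ^ (eM + k - 1)

/-- `M′_ν ≠ 0`. [folklore] -/
theorem kingZeroVol_neZero (k eM : ℕ) : ∀ μ, NeZero (kingZeroVol (d := d) L k eM μ) :=
  fun _ => ⟨mul_ne_zero two_ne_zero (pow_ne_zero _ (NeZero.ne L))⟩

omit [NeZero L] in
/-- The finest slice's period identity (`k ≥ 1`): `L^k·2L^{e_M} = L^1·2L^{e_M+k−1}`. [cite: King1986, (2.20) p.654] -/
theorem kingZero_carrier {k eM : ℕ} (M : Fin (d + 1) → ℕ) (hM : ∀ μ, M μ = 2 * L ^ eM) (hk : 1 ≤ k) :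
    ∀ μ, fine (L ^ k) M μ = fine (L ^ 1) (kingZeroVol (d := d) L k eM) μ := by
  intro μ
  show L ^ k * M μ = L ^ 1 * (2 * L ^ (eM + k - 1))
  rw [hM μ]
  have hk' : eM + k - 1 + 1 = k + eM := by omega
  calc L ^ k * (2 * L ^ eM) = 2 * L ^ (k + eM) := by rw [pow_add]; ring
    _ = 2 * L ^ (eM + k - 1 + 1) := by rw [hk']
    _ = L ^ 1 * (2 * L ^ (eM + k - 1)) := by rw [pow_succ, pow_one]; ring

/-- **THE SLICE KERNELS IN LEVEL-`k` UNITS** on the carrier `T_η = Tor (fine (L^k) M)`: for `1 ≤ j < k`, `(L^jη)^{2−D}·𝒢_j` at the mass `m²(L^jη)²`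
(part K's `ksSlice` through part Ρ-a's `torCongr`); for `j = 0`, `η^{2−D}·L²·(fineOp L M′ a_1 L² (L²m²η²))⁻¹ = η^{2−D}C^{(0),η}`; `0` for `j ≥ k`.
[cite: King1986, (2.17) p.653, (2.20) p.654] -/
def kingSliceG (k eM : ℕ) (M : Fin (d + 1) → ℕ) [∀ μ, NeZero (M μ)] (hM : ∀ μ, M μ = 2 * L ^ eM) (hk : 1 ≤ k) (a msq : ℝ) (j : ℕ)
    (x y : Tor (fine (L ^ k) M)) : ℝ :=
  if h : 1 ≤ j ∧ j < k then
    ((L : ℝ) ^ j / (L : ℝ) ^ k) ^ ((2 : ℝ) - (d + 1 : ℕ)) *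
      ksSlice L a (msq * ((L : ℝ) ^ j / (L : ℝ) ^ k) ^ 2) (kingSliceIdx k eM j h.1)
        (torCongr (kingSliceIdx_carrier L M hM h.1 h.2) x) (torCongr (kingSliceIdx_carrier L M hM h.1 h.2) y)
  else if j = 0 then
    haveI := kingZeroVol_neZero (d := d) L k eM
    ((1 : ℝ) / (L : ℝ) ^ k) ^ ((2 : ℝ) - (d + 1 : ℕ)) * ((L : ℝ) ^ 2 *
      (fineOp (L ^ 1) (kingZeroVol L k eM) (aK a L 1) (((L ^ 1 : ℕ) : ℝ) ^ 2) (msq * (L : ℝ) ^ 2 * ((1 : ℝ) / (L : ℝ) ^ k) ^ 2))⁻¹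
        (torCongr (kingZero_carrier L M hM hk) x) (torCongr (kingZero_carrier L M hM hk) y))
  else 0

/-- ★ **THE DATUM**: King's genuine slices of the `k`-level `A = 0` propagator on ONE carrier, in the letters of the schema (module docstring).
[cite: King1986, (2.17) p.653, (2.20) p.654, Prop. 3.7 (3.63)–(3.65) p.663] -/
def kingSliceKernels (k eM : ℕ) (M : Fin (d + 1) → ℕ) [∀ μ, NeZero (M μ)] (hM : ∀ μ, M μ = 2 * L ^ eM) (hk : 1 ≤ k) (a msq : ℝ) :
    SliceKernels (d + 1) where
  S := Tor (fine (L ^ k) M)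
  B := PEmpty
  dist := fun x y => tdistT (fine (L ^ k) M) x y / (L : ℝ) ^ k
  distBlockBond := fun _ _ b => nomatch b
  L := L
  k := k
  G := kingSliceG L k eM M hM hk a msq
  dG := fun j μ x y => (L : ℝ) ^ k * (kingSliceG L k eM M hM hk a msq j (x + unitVec (fine (L ^ k) M) μ) y - kingSliceG L k eM M hM hk a msq j x y)
  Gc := fun _ _ b => nomatch b

/-! ## §2 Reading the datum -/

section Reading

variable {L} {k eM : ℕ} (M : Fin (d + 1) → ℕ) [∀ μ, NeZero (M μ)] (hM : ∀ μ, M μ = 2 * L ^ eM) (hk : 1 ≤ k) (a msq : ℝ)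

/-- The slice lengths of the datum: `L^jη = L^j∕L^k`. [cite: King1986, (3.63) p.663] -/
theorem kingSliceKernels_slice (j : ℕ) : (kingSliceKernels L k eM M hM hk a msq).slice j = (L : ℝ) ^ j / (L : ℝ) ^ k := by
  show (L : ℝ) ^ j * (((L : ℝ) ^ k)⁻¹) = _
  rw [div_eq_mul_inv]

/-- The kernel of slice `1 ≤ j < k`. [cite: King1986, (2.17) p.653] -/
theorem kingSliceG_of_pos {j : ℕ} (hj : 1 ≤ j) (hjk : j < k) (x y : Tor (fine (L ^ k) M)) :
    kingSliceG L k eM M hM hk a msq j x y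
      = ((L : ℝ) ^ j / (L : ℝ) ^ k) ^ ((2 : ℝ) - (d + 1 : ℕ)) *
          ksSlice L a (msq * ((L : ℝ) ^ j / (L : ℝ) ^ k) ^ 2) (kingSliceIdx k eM j hj)
            (torCongr (kingSliceIdx_carrier L M hM hj hjk) x) (torCongr (kingSliceIdx_carrier L M hM hj hjk) y) := by
  unfold kingSliceG
  rw [dif_pos ⟨hj, hjk⟩]

/-- The kernel of the finest slice `j = 0`. [cite: King1986, (2.16)–(2.17) p.653] -/
theorem kingSliceG_zero (x y : Tor (fine (L ^ k) M)) :
    kingSliceG L k eM M hM hk a msq 0 x y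
      = haveI := kingZeroVol_neZero (d := d) L k eM
        ((1 : ℝ) / (L : ℝ) ^ k) ^ ((2 : ℝ) - (d + 1 : ℕ)) * ((L : ℝ) ^ 2 *
          (fineOp (L ^ 1) (kingZeroVol L k eM) (aK a L 1) (((L ^ 1 : ℕ) : ℝ) ^ 2) (msq * (L : ℝ) ^ 2 * ((1 : ℝ) / (L : ℝ) ^ k) ^ 2))⁻¹
            (torCongr (kingZero_carrier L M hM hk) x) (torCongr (kingZero_carrier L M hM hk) y)) := by
  unfold kingSliceG
  rw [dif_neg (by omega), if_pos rfl]

end Reading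

/-! ## §3 Exponent bookkeeping -/

section Rpow

omit [NeZero L]

/-- `s^{2−D}·(s·X) = … `: for `s > 0`, `s^{e}·s = s^{e+1}`. [folklore] -/
theorem rpow_mul_self_eq {s e : ℝ} (hs : 0 < s) : s ^ e * s = s ^ (e + 1) := by
  rw [Real.rpow_add hs, Real.rpow_one]

/-- For `t, A, B > 0`: `(t∕A)^{−α}·(t∕B)^{α} = (B∕A)^{−α}`. [folklore] -/
theorem div_rpow_neg_mul_div_rpow {t A B α : ℝ} (ht : 0 < t) (hA : 0 < A) (hB : 0 < B) :
    (t / A) ^ (-α) * (t / B) ^ α = (B / A) ^ (-α) := by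
  rw [Real.rpow_neg (div_pos ht hA).le, Real.rpow_neg (div_pos hB hA).le, ← Real.inv_rpow (div_pos ht hA).le,
    ← Real.inv_rpow (div_pos hB hA).le, ← Real.mul_rpow (inv_nonneg.mpr (div_pos ht hA).le) (div_pos ht hB).le]
  congr 1
  field_simp

/-- `s^{e}·s^{−α} = s^{e−α}` (`s > 0`). [folklore] -/
theorem rpow_mul_rpow_neg_eq {s e α : ℝ} (hs : 0 < s) : s ^ e * s ^ (-α) = s ^ (e - α) := by
  rw [← Real.rpow_add hs]; ring_nf

end Rpow

/-! ## §4 The weight identity -/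

section Clauses

variable {L}

omit [NeZero L] in
/-- The schema's exponential weight at slice `j` IS the letters' weight: `δ·(L^j∕L^k)⁻¹·(t∕L^k) = δ·(t∕L^j)`. [folklore] -/
theorem sliceWeight_eq (hL0 : (0 : ℝ) < L) (δ t : ℝ) (j k : ℕ) :
    δ * ((L : ℝ) ^ j / (L : ℝ) ^ k)⁻¹ * (t / (L : ℝ) ^ k) = δ * (t / (L : ℝ) ^ j) := by
  have hj : (0 : ℝ) < (L : ℝ) ^ j := pow_pos hL0 _
  have hk : (0 : ℝ) < (L : ℝ) ^ k := pow_pos hL0 _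
  field_simp

/-- Reading the datum's distance. [folklore] -/
theorem kingSliceKernels_dist {k eM : ℕ} (M : Fin (d + 1) → ℕ) [∀ μ, NeZero (M μ)] (hM : ∀ μ, M μ = 2 * L ^ eM) (hk : 1 ≤ k) (a msq : ℝ)
    (u v : Tor (fine (L ^ k) M)) : (kingSliceKernels L k eM M hM hk a msq).dist u v = tdistT (fine (L ^ k) M) u v / (L : ℝ) ^ k := rfl

/-- Reading the datum's kernels. [folklore] -/
theorem kingSliceKernels_G {k eM : ℕ} (M : Fin (d + 1) → ℕ) [∀ μ, NeZero (M μ)] (hM : ∀ μ, M μ = 2 * L ^ eM) (hk : 1 ≤ k) (a msq : ℝ)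
    (j : ℕ) (u v : Tor (fine (L ^ k) M)) : (kingSliceKernels L k eM M hM hk a msq).G j u v = kingSliceG L k eM M hM hk a msq j u v := rfl

/-- Reading the datum's gradient kernels. [folklore] -/
theorem kingSliceKernels_dG {k eM : ℕ} (M : Fin (d + 1) → ℕ) [∀ μ, NeZero (M μ)] (hM : ∀ μ, M μ = 2 * L ^ eM) (hk : 1 ≤ k) (a msq : ℝ)
    (j : ℕ) (μ : Fin (d + 1)) (u v : Tor (fine (L ^ k) M)) :
    (kingSliceKernels L k eM M hM hk a msq).dG j μ u v
      = (L : ℝ) ^ k * (kingSliceG L k eM M hM hk a msq j (u + unitVec (fine (L ^ k) M) μ) v - kingSliceG L k eM M hM hk a msq j u v) := rfl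

end Clauses

end Summit.QuantumFields.YangMills.BalabanUVNodes.N15KingModelRung.Curved

end
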